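import Literature.NumberTheory.Automorphic.CuspTowerTransport
import HarnessLib

/-!
# The last column of the corner is a block: the stage hypothesis `hcusp` from the tower invariant,
and independence of the column coefficient from the Haar measure
(Cogdell, *Analytic theory of L-functions for GL_n* (2004), §1.1, proof of Thm. 1.1)

Topic `NumberTheory/Automorphic`; namespace `Literature.NumberTheory.Automorphic`. Sequel to
`CuspTowerTransport`. Two book-keeping facts for the Fourier–Whittaker tower:

* `colCoeff_eq_of_isAddHaarMeasure` — **the column coefficient does not depend on the Haar measure**
  (`colCoeff` is normalised by `ν(D)⁻¹`; two additive Haar measures on `𝔸_K^{c+1}` are proportional,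
  Mathlib `Measure.isAddLeftInvariant_eq_smul`);
* `lastColIdx`, `reindexLastCol` (**definitions**): the bijection `Fin (c+1) ≃ BlockIdx (c+2) (c+1)`
  (the block `𝔫_{c+1}` of `GL_{c+2}` is its last column) and the induced additive homeomorphism of
  box coordinates; `unipotentOfBlock_blockMatrixEquiv_reindexLastCol` — in `GL_n`,
  `diag(1 + N_v, 1) = u(v)` (`colUnipotent`);
* `colCoeff_zero_eq_zero_of_towerCusp` (**the stage hypothesis**): if `TowerCusp (c + 2 ≤ n) φ` then
  `colCoeff (c + 1 ≤ n) ν φ 0 x = 0` for every Haar `ν` and every `x` — the case `k = c + 1` of the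
  invariant, transported along `reindexLastCol`.

## References

* J. W. Cogdell, in Bernstein–Gelbart (eds.), *An Introduction to the Langlands Program* (2004),
  §1.1 [CogdellAnalyticTheory2004].
-/

noncomputable section

open scoped Matrix ComplexConjugate ENNReal NNReal Pointwise
open NumberField IsDedekindDomain MeasureTheory Function
open Literature.LinearAlgebra.Matrix

namespace Literature.NumberTheory.Automorphic

/-! ### Independence of the Haar measure -/

section Haar

variable (K : Type) [Field K] [NumberField K] {n c : ℕ} [MeasurableSpace (AdeleRing (𝓞 K) K)]
  [BorelSpace (AdeleRing (𝓞 K) K)]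

variable {K} in
/-- **`colCoeff` does not depend on the choice of the additive Haar measure** on `𝔸_K^{c+1}`: two
such measures are proportional (`ν' = a ν`, `a ≠ 0`) and the normalisation `ν(D)⁻¹` cancels `a`.
[folklore] -/
theorem colCoeff_eq_of_isAddHaarMeasure (h : c + 1 ≤ n) (ν ν' : Measure (Fin (c + 1) → AdeleRing (𝓞 K) K))
    [ν.IsAddHaarMeasure] [ν'.IsAddHaarMeasure] (φ : GL (Fin n) (AdeleRing (𝓞 K) K) → ℂ)
    (ξ : Fin (c + 1) → K) (x : GL (Fin n) (AdeleRing (𝓞 K) K)) :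
    colCoeff h ν' φ ξ x = colCoeff h ν φ ξ x := by
  haveI := locallyCompactSpace_adeleRing' K
  haveI := secondCountableTopology_adeleRing K
  haveI := t2Space_adeleRing K
  haveI : BorelSpace (Fin (c + 1) → AdeleRing (𝓞 K) K) := Pi.borelSpace
  set a : ℝ≥0 := Measure.addHaarScalarFactor ν' ν with ha
  have hν' : ν' = a • ν := Measure.isAddLeftInvariant_eq_smul ν' ν
  have ha0 : a ≠ 0 := by
    intro h0
    rw [h0, zero_smul] at hν'
    have hne : ν' Set.univ ≠ 0 := isOpen_univ.measure_ne_zero ν' Set.univ_nonempty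
    rw [hν'] at hne
    exact hne rfl
  rw [colCoeff_apply, colCoeff_apply, hν', Measure.smul_apply, Measure.restrict_smul,
    integral_smul_nnreal_measure]
  rw [ENNReal.smul_def, smul_eq_mul, ENNReal.toReal_mul, ENNReal.coe_toReal, mul_inv, NNReal.smul_def,
    smul_smul]
  congr 1
  rw [mul_comm ((a : ℝ)⁻¹) _, mul_assoc, inv_mul_cancel₀ (NNReal.coe_ne_zero.2 ha0), mul_one]

end Haar

/-! ### The last column of `GL_{c+2}` as the block `𝔫_{c+1}` -/

section LastCol

variable (R : Type*) [CommRing R] (c : ℕ)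

/-- Every index of the block `𝔫_{c+1} ≤ M_{c+2}` lies in the last column. [folklore] -/
theorem BlockIdx.snd_val_eq (p : BlockIdx (c + 2) (c + 1)) : ((p.1.2 : Fin (c + 2)) : ℕ) = c + 1 := by
  have h1 := p.2.2
  have h2 := p.1.2.isLt
  omega

/-- **The bijection `Fin (c+1) ≃ BlockIdx (c+2) (c+1)`**, `i ↦ (i, c+1)`. [folklore] -/
def lastColIdx : Fin (c + 1) ≃ BlockIdx (c + 2) (c + 1) where
  toFun i := ⟨(⟨i, by omega⟩, ⟨c + 1, by omega⟩), ⟨i.isLt, le_rfl⟩⟩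
  invFun p := ⟨p.1.1, p.2.1⟩
  left_inv i := Fin.ext rfl
  right_inv p := by
    refine Subtype.ext (Prod.ext (Fin.ext rfl) (Fin.ext ?_))
    simp only
    exact (BlockIdx.snd_val_eq c p).symm

/-- **Reindexing box coordinates along `lastColIdx`**: `v ↦ (p ↦ v (lastColIdx⁻¹ p))`, an additive
equivalence `R^{c+1} ≃+ R^{BlockIdx (c+2) (c+1)}`. [folklore] -/
def reindexLastCol : (Fin (c + 1) → R) ≃+ (BlockIdx (c + 2) (c + 1) → R) where
  toFun v p := v ((lastColIdx c).symm p)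
  invFun N i := N (lastColIdx c i)
  left_inv v := funext fun i => by simp
  right_inv N := funext fun p => by simp
  map_add' v w := rfl

/-- `reindexLastCol v p = v (lastColIdx⁻¹ p)` (definitional). [folklore] -/
@[simp]
theorem reindexLastCol_apply (v : Fin (c + 1) → R) (p : BlockIdx (c + 2) (c + 1)) :
    reindexLastCol R c v p = v ((lastColIdx c).symm p) := rfl

variable {R} in
/-- **In `GL_n`, the block unipotent of the reindexed column is the column unipotent**:
`diag(1 + N_v, 1_{n-c-2}) = u(v)` with `N_v = blockMatrixEquiv (reindexLastCol v)`. [folklore] -/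
theorem glCorner_unipotentOfBlock_reindexLastCol {n : ℕ} (h : c + 1 ≤ n) (h2 : c + 2 ≤ n)
    (v : Fin (c + 1) → R) :
    glCorner R h2 (unipotentOfBlock (c + 2) (c + 1) R
      (Multiplicative.ofAdd (blockMatrixEquiv R (c + 2) (c + 1) (reindexLastCol R c v)))) =
      colUnipotent n h (Multiplicative.ofAdd v) := by
  rw [colUnipotent_eq_glCorner_colUnipotent h h2]
  congr 1
  refine Units.ext (Matrix.ext fun i j => ?_)
  rw [coe_unipotentOfBlock, toAdd_ofAdd, Matrix.add_apply, coe_blockMatrixEquiv_apply, colUnipotent_apply_val,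
    Matrix.one_apply]
  congr 1
  by_cases hi : (i : ℕ) < c + 1
  · by_cases hj : c + 1 ≤ (j : ℕ)
    · rw [dif_pos ⟨hi, hj⟩, dif_pos hi, if_pos (by have := j.isLt; omega), reindexLastCol_apply]
      rfl
    · rw [dif_neg (fun h => hj h.2), dif_pos hi, if_neg (by omega)]
  · rw [dif_neg (fun h => hi h.1), dif_neg hi]

variable [TopologicalSpace R]

variable {R} in
/-- `reindexLastCol` is continuous. [folklore] -/
theorem continuous_reindexLastCol : Continuous (reindexLastCol R c) :=
  continuous_pi fun _ => continuous_apply _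

variable {R} in
/-- Its inverse is continuous. [folklore] -/
theorem continuous_reindexLastCol_symm : Continuous (reindexLastCol R c).symm :=
  continuous_pi fun _ => continuous_apply _

/-- `reindexLastCol` as a homeomorphism. [folklore] -/
def reindexLastColHomeomorph : (Fin (c + 1) → R) ≃ₜ (BlockIdx (c + 2) (c + 1) → R) where
  toEquiv := (reindexLastCol R c).toEquiv
  continuous_toFun := continuous_reindexLastCol c
  continuous_invFun := continuous_reindexLastCol_symm c

end LastCol

/-! ### The stage hypothesis from the tower invariant -/

section Stage

variable (K : Type) [Field K] [NumberField K] {n c : ℕ} [MeasurableSpace (AdeleRing (𝓞 K) K)]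
  [BorelSpace (AdeleRing (𝓞 K) K)]

omit [MeasurableSpace (AdeleRing (𝓞 K) K)] [BorelSpace (AdeleRing (𝓞 K) K)] in
/-- Reindexing maps Tate's box onto Tate's box: `reindexLastCol ⁻¹' D^{BlockIdx} = D^{c+1}`. [folklore] -/
theorem preimage_reindexLastCol_piFundamentalDomain :
    reindexLastCol (AdeleRing (𝓞 K) K) c ⁻¹' piFundamentalDomain K (BlockIdx (c + 2) (c + 1)) =
      piFundamentalDomain K (Fin (c + 1)) := by
  ext v
  simp only [Set.mem_preimage, piFundamentalDomain, Set.mem_univ_pi]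
  constructor
  · intro h i
    simpa using h (lastColIdx c i)
  · intro h p
    exact h _

variable {K} in
/-- **The stage hypothesis `hcusp` from the tower invariant.** If all block constant terms of `φ`
inside the corner `GL_{c+2}` vanish (`TowerCusp (c + 2 ≤ n) φ`), then the `ξ = 0` column coefficient
of `φ` along the column group `u : 𝔸_K^{c+1} → GL_n(𝔸_K)` vanishes at every point, for every additive
Haar measure: `colCoeff (c + 1 ≤ n) ν φ 0 x = 0` — the case `k = c + 1`, transported along
`reindexLastCol` (transported Haar measure; the box corresponds to the box).
[cite: CogdellAnalyticTheory2004, §1.1] -/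
theorem colCoeff_zero_eq_zero_of_towerCusp (h : c + 1 ≤ n) (h2 : c + 2 ≤ n)
    {φ : GL (Fin n) (AdeleRing (𝓞 K) K) → ℂ} (hφ : TowerCusp h2 φ)
    (ν : Measure (Fin (c + 1) → AdeleRing (𝓞 K) K)) [ν.IsAddHaarMeasure]
    (x : GL (Fin n) (AdeleRing (𝓞 K) K)) : colCoeff h ν φ 0 x = 0 := by
  haveI := t2Space_adeleRing K
  haveI := secondCountableTopology_adeleRing K
  haveI : BorelSpace (Fin (c + 1) → AdeleRing (𝓞 K) K) := Pi.borelSpace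
  haveI : BorelSpace (BlockIdx (c + 2) (c + 1) → AdeleRing (𝓞 K) K) := Pi.borelSpace
  set Ψ := reindexLastCol (AdeleRing (𝓞 K) K) c with hΨ
  haveI : (Measure.map Ψ ν).IsAddHaarMeasure :=
    AddEquiv.isAddHaarMeasure_map ν Ψ (continuous_reindexLastCol c) (continuous_reindexLastCol_symm c)
  have h0 := hφ (c + 1) (Nat.succ_pos c) (by omega) (Measure.map Ψ ν) inferInstance x
  have hmp : MeasurePreserving Ψ ν (Measure.map Ψ ν) := ⟨(continuous_reindexLastCol c).measurable, rfl⟩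
  have hme : MeasurableEmbedding Ψ :=
    (reindexLastColHomeomorph (AdeleRing (𝓞 K) K) c).measurableEmbedding
  rw [blockCT_apply, ← hmp.setIntegral_preimage_emb hme, preimage_reindexLastCol_piFundamentalDomain] at h0
  simp_rw [hΨ, glCorner_unipotentOfBlock_reindexLastCol c h h2] at h0
  rw [colCoeff_zero, h0, smul_zero]

end Stage

end Literature.NumberTheory.Automorphic
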